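import Mathlib.Algebra.CharZero.Infinite
import Mathlib.Algebra.MvPolynomial.Equiv
import Mathlib.Algebra.MvPolynomial.Funext
import Mathlib.Algebra.MvPolynomial.Polynomial
import Mathlib.Algebra.Polynomial.FieldDivision
import Mathlib.Algebra.Polynomial.Roots
import Mathlib.Analysis.Calculus.ContDiff.Basic
import Mathlib.Analysis.Calculus.ContDiff.Polynomial
import Mathlib.Analysis.Calculus.Deriv.Polynomial
import Mathlib.Analysis.Calculus.IteratedDeriv.Lemmas
import Mathlib.LinearAlgebra.Dimension.Constructions
import Mathlib.LinearAlgebra.Dimension.Finite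
import Mathlib.LinearAlgebra.FiniteDimensional.Lemmas
import Literature.NumberTheory.Transcendental.PhilipponZeroEstimate
import HarnessLib

/-!
# Philippon's zero estimate on `𝔾ₐ × 𝔾ₘ^m`: proved complements

Topic `Literature/NumberTheory/Transcendental`. Companion to `PhilipponZeroEstimate.lean` (named fact
`Literature.NumberTheory.Transcendental.Philippon1986_GaGm`, Philippon 1986, Théorème 2.1 for
`G = 𝔾ₐ × 𝔾ₘ^m ⊂ ℙ¹ × ℙ^m`). The general discharge needs the multihomogeneous Hilbert–Samuel /
Bézout theory of op. cit. §3 (Prop. 3.3), the derivation–translation operators and Wüstholz's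
multiplicity lemma of §4 (Prop. 4.7) and the obstruction-subgroup argument of §5 (Lemme 5.1), none
of which is in Mathlib; moreover the fact is already a proved consequence of the finer vendoring
`Philippon1986_GaGm_P1n` (`PhilipponZeroEstimateP1n.lean`, `Philippon1986_GaGm_of_P1n`). What is
PROVED here:

* small API for the two extreme connected algebraic subgroups: `Lie {e} = 0`, `Lie G = ℂ × ℂ^m`
  (`GaGm.ConnAlgSubgroup.tangent_bot`, `tangent_top`, `addDim_*`, `torusDim_*`);
* `GaGm.eq_zero_of_forall_evalAt_mul`: a polynomial vanishing on a translate of the whole group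
  `G(ℂ) = ℂ × (ℂˣ)^m` is zero — the remark "hence `G' ≠ G`" of the fact's docstring (the
  obstruction subgroup produced by Théorème 2.1 for a non-zero `P` is never `top`);
* `Philippon1986_GaGm_caseZero`: the instance `m = 0` of the body of `Philippon1986_GaGm`
  (`G = 𝔾ₐ ⊂ ℙ¹`, `n = 1`): a non-zero `P ∈ ℂ[X]` of degree `≤ D₀` vanishing to order `≥ T + 1`
  along the (only) analytic subgroup `A = 𝔾ₐ(ℂ)` at every point of a finite `Σ ∋ 0` has
  `(T + 1) · card Σ ≤ D₀` zeros counted with multiplicity, which is the printed inequality with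
  `G' = {e}`, `c = 1` (`H(𝔾ₐ; D₀) = D₀`). The proof identifies the Fréchet-derivative encoding
  `GaGm.VanishesToOrder` with root multiplicity (`Polynomial.rootMultiplicity`) and counts roots.

## References

* P. Philippon, *Lemmes de zéros dans les groupes algébriques commutatifs*, Bull. Soc. Math.
  France 114 (1986), 355–383 (doi:10.24033/bsmf.2060), §2, Théorème 2.1 (p. 358); Errata et
  addenda, ibid. 115 (1987), 397–398 (doi:10.24033/bsmf.2084).
-/

noncomputable section

open MvPolynomial Complex

namespace Literature.NumberTheory.Transcendental

namespace GaGm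

variable {m : ℕ}

namespace ConnAlgSubgroup

/-- The torus part of the trivial subgroup has zero Lie algebra:
`{v ∈ ℂ^m ; ∑ χⱼvⱼ = 0 ∀ χ ∈ ℤ^m} = 0`. [folklore] -/
@[simp] theorem torusTangent_bot (m : ℕ) : (bot m).torusTangent = ⊥ := by
  refine (Submodule.eq_bot_iff _).mpr fun v hv => ?_
  funext j
  have h : ∑ i, ((Pi.single j 1 : Fin m → ℤ) i : ℂ) * v i = 0 :=
    hv (Pi.single j 1) (AddSubgroup.mem_top _)
  rw [Finset.sum_eq_single j (fun b _ hb => by simp [Pi.single_eq_of_ne hb])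
    (fun hj => absurd (Finset.mem_univ j) hj)] at h
  simpa using h

/-- `Lie {e} = 0`. [folklore] -/
@[simp] theorem tangent_bot (m : ℕ) : (bot m).tangent = ⊥ := by
  rw [tangent, torusTangent_bot]
  simp [bot]

/-- The trivial subgroup has no additive part: `δ₀({e}) = 0`. [folklore] -/
@[simp] theorem addDim_bot (m : ℕ) : (bot m).addDim = 0 := by
  simp [addDim, bot]

/-- The trivial subgroup has torus dimension `δ₁({e}) = 0`. [folklore] -/
@[simp] theorem torusDim_bot (m : ℕ) : (bot m).torusDim = 0 := by
  rw [torusDim, torusTangent_bot]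
  exact finrank_bot ℂ (Fin m → ℂ)

/-- The torus part of the whole group has Lie algebra `ℂ^m`. [folklore] -/
@[simp] theorem torusTangent_top (m : ℕ) : (top m).torusTangent = ⊤ := by
  refine Submodule.eq_top_iff'.mpr fun v χ hχ => ?_
  have hχ0 : χ = 0 := by simpa [top] using hχ
  simp [hχ0]

/-- `Lie G = ℂ × ℂ^m`. [folklore] -/
@[simp] theorem tangent_top (m : ℕ) : (top m).tangent = ⊤ := by
  rw [tangent, torusTangent_top]
  simp [top]

/-- The whole group has additive part `𝔾ₐ`: `δ₀(G) = 1`. [folklore] -/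
@[simp] theorem addDim_top (m : ℕ) : (top m).addDim = 1 := by
  simp [addDim, top]

/-- The whole group has torus dimension `δ₁(G) = m`. [folklore] -/
@[simp] theorem torusDim_top (m : ℕ) : (top m).torusDim = m := by
  rw [torusDim, torusTangent_top, finrank_top, Module.finrank_fin_fun]

end ConnAlgSubgroup

/-- Restriction of `P ∈ ℂ[X, Y₁, …, Y_m]` to the line `t ↦ (z₀, z₁ + t, …, z_m + t)`:
`P(z₀, z₁ + t, …, z_m + t)` as a polynomial in `t` evaluates as expected. [folklore] -/
theorem eval_lineRestrict (z : Fin (m + 1) → ℂ) (P : MvPolynomial (Fin (m + 1)) ℂ) (t : ℂ) :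
    Polynomial.eval t (MvPolynomial.eval₂ Polynomial.C
        (Fin.cons (Polynomial.C (z 0)) fun j => Polynomial.C (z j.succ) + Polynomial.X) P) =
      MvPolynomial.eval (Fin.cons (z 0) fun j => z j.succ + t) P := by
  rw [MvPolynomial.polynomial_eval_eval₂]
  have hC : (Polynomial.evalRingHom t).comp Polynomial.C = RingHom.id ℂ :=
    RingHom.ext fun r => by simp
  have hG : (fun i => Polynomial.eval t ((Fin.cons (Polynomial.C (z 0))
      (fun j => Polynomial.C (z j.succ) + Polynomial.X) : Fin (m + 1) → Polynomial ℂ) i)) =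
      Fin.cons (z 0) (fun j => z j.succ + t) := by
    funext i
    refine Fin.cases ?_ (fun j => ?_) i <;> simp
  rw [hC, hG]
  rfl

/-- **A polynomial vanishing on a translate `g · G(ℂ)` of the whole group — i.e. on all of
`ℂ × (ℂˣ)^m` — is zero.** In particular the obstruction subgroup `G'` of `Philippon1986_GaGm`
(contained in a translate of `𝒵(P)`, `P ≠ 0`) is never `top`: "hence `G' ≠ G`".
Proof: restricted to the line `t ↦ (z₀, z₁ + t, …, z_m + t)` through an arbitrary `z ∈ ℂ^{m+1}`,
`P` has infinitely many zeros (all `t ∉ {-z₁, …, -z_m}`), so vanishes at `t = 0`. [folklore] -/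
theorem eq_zero_of_forall_evalAt_mul {P : MvPolynomial (Fin (m + 1)) ℂ} {g : GaGm m}
    (hP : ∀ h ∈ (ConnAlgSubgroup.top m).toSubgroup, evalAt P (g * h) = 0) : P = 0 := by
  have hall : ∀ x : GaGm m, evalAt P x = 0 := fun x => by
    simpa using hP (g⁻¹ * x) (ConnAlgSubgroup.mem_toSubgroup_top _)
  apply MvPolynomial.funext
  intro z
  rw [map_zero]
  -- the univariate restriction `q(t) = P(z₀, z₁ + t, …, z_m + t)`
  set q : Polynomial ℂ := MvPolynomial.eval₂ Polynomial.C
    (Fin.cons (Polynomial.C (z 0)) fun j => Polynomial.C (z j.succ) + Polynomial.X) P with hq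
  have hroot : ∀ t : ℂ, (∀ j : Fin m, z j.succ + t ≠ 0) → q.IsRoot t := by
    intro t ht
    have h := hall (Multiplicative.ofAdd (z 0), fun j => Units.mk0 (z j.succ + t) (ht j))
    have hc : coord ((Multiplicative.ofAdd (z 0), fun j => Units.mk0 (z j.succ + t) (ht j)) :
        GaGm m) = Fin.cons (z 0) (fun j => z j.succ + t) := by
      funext i
      refine Fin.cases ?_ (fun j => ?_) i <;> simp [coord]
    rw [evalAt, hc] at h
    show q.eval t = 0
    rw [hq, eval_lineRestrict]
    exact h
  have hq0 : q = 0 := by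
    apply Polynomial.eq_zero_of_infinite_isRoot
    have hfin : ({t : ℂ | ∀ j : Fin m, z j.succ + t ≠ 0}ᶜ).Finite := by
      refine (Set.finite_range fun j : Fin m => -z j.succ).subset ?_
      intro t ht
      simp only [Set.mem_compl_iff, Set.mem_setOf_eq, not_forall, not_not] at ht
      obtain ⟨j, hj⟩ := ht
      exact ⟨j, by linear_combination -hj⟩
    have hinf := hfin.infinite_compl
    rw [compl_compl] at hinf
    exact hinf.mono fun t ht => hroot t ht
  have h0 := eval_lineRestrict z P 0
  rw [← hq, hq0, Polynomial.eval_zero] at h0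
  simp only [add_zero] at h0
  rw [h0]
  exact congrArg (fun x => MvPolynomial.eval x P) (Fin.cons_self_tail z).symm

/-- Iterated derivatives of a polynomial function are the values of its iterated formal
derivatives. [folklore] -/
theorem iteratedDeriv_polynomial_eval (p : Polynomial ℂ) (k : ℕ) :
    iteratedDeriv k (fun x : ℂ => p.eval x) = fun x => (Polynomial.derivative^[k] p).eval x := by
  induction k generalizing p with
  | zero => simp
  | succ k ih =>
    rw [iteratedDeriv_succ', Function.iterate_succ_apply]
    have hd : deriv (fun x : ℂ => p.eval x) = fun x => p.derivative.eval x :=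
      funext fun x => p.deriv
    rw [hd, ih]

end GaGm

open GaGm in
/-- **The case `m = 0` (`G = 𝔾ₐ`) of `Philippon1986_GaGm`, proved.** This is literally the body of
the named fact `Philippon1986_GaGm` at `m = 0`, with the constant `c = 1`: for a non-zero
`P ∈ ℂ[X]` with `deg P ≤ D₀`, a non-zero subspace `W` of `Lie 𝔾ₐ = ℂ` (so `W = ℂ`, `A = 𝔾ₐ(ℂ)`),
and a finite `Σ ∋ 0` at every point of which (`Σ(1) = Σ`) `P` vanishes to order `≥ T + 1` along `A`,
the subgroup `G' = {e}` (`= bot 0`) lies in the translate `Σ ∋ 0` of `𝒵(P)` and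
`binom(T + 1, 1) · card Σ · D₀⁰ · D₁⁰ = (T + 1) · card Σ ≤ D₀ = H(𝔾ₐ; D₀)` — root counting with
multiplicities (`∑_{σ ∈ Σ} mult_σ(P) ≤ deg P`). Philippon 1986, Théorème 2.1 with `p = 1`,
`G = 𝔾ₐ ⊂ ℙ¹`, `n = 1`, `c₁ = 1`. [cite: Philippon1986, Thm 2.1 (case G = 𝔾ₐ)] -/
theorem Philippon1986_GaGm_caseZero :
    ∃ c : ℕ, ∀ (D₀ D₁ T : ℕ) (W : Submodule ℂ (ℂ × (Fin 0 → ℂ))) (S : Set (GaGm 0))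
      (P : MvPolynomial (Fin (0 + 1)) ℂ),
    1 ≤ D₀ → 1 ≤ D₁ → 0 < Module.finrank ℂ W → S.Finite → (1 : GaGm 0) ∈ S → P ≠ 0 →
    P.degreeOf 0 ≤ D₀ → (∀ s ∈ P.support, ∑ j : Fin 0, s (Fin.succ j) ≤ D₁) →
    (∀ g ∈ sumset S (0 + 1), VanishesToOrder P W g ((0 + 1) * T + 1)) →
    ∃ H : ConnAlgSubgroup 0,
      (∃ g : GaGm 0, ∀ h ∈ H.toSubgroup, evalAt P (g * h) = 0) ∧
      Nat.choose (T + (Module.finrank ℂ W - Module.finrank ℂ ↥(W ⊓ H.tangent)))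
          (Module.finrank ℂ W - Module.finrank ℂ ↥(W ⊓ H.tangent)) *
        Set.ncard ((QuotientGroup.mk : GaGm 0 → GaGm 0 ⧸ H.toSubgroup) '' S) *
        D₀ ^ H.addDim * D₁ ^ H.torusDim ≤ c * D₀ * D₁ ^ 0 := by
  classical
  refine ⟨1, ?_⟩
  intro D₀ D₁ T W S P _hD₀ _hD₁ hW hS h1 hP hdeg _hY hvan
  have hS_sub : S ⊆ sumset S (0 + 1) := subset_sumset h1 (by norm_num)
  -- the univariate polynomial `p(X) = P`
  set p : Polynomial ℂ :=
    Polynomial.map (MvPolynomial.eval Fin.elim0) (MvPolynomial.finSuccEquiv ℂ 0 P) with hp_def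
  have hevalP : ∀ (y : ℂ) (s : Fin 0 → ℂ), MvPolynomial.eval (Fin.cons y s) P = p.eval y := by
    intro y s
    rw [Subsingleton.elim s Fin.elim0]
    exact MvPolynomial.eval_eq_eval_mv_eval' Fin.elim0 y P
  have hp0 : p ≠ 0 := by
    intro hp
    apply hP
    apply MvPolynomial.funext
    intro x
    rw [← Fin.cons_self_tail x, hevalP, hp, Polynomial.eval_zero, map_zero]
  have hpdeg : p.natDegree ≤ D₀ :=
    Polynomial.natDegree_map_le.trans ((MvPolynomial.natDegree_finSuccEquiv P).le.trans hdeg)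
  -- a vector of `W` with non-zero (first, i.e. only) coordinate
  have hWne : W ≠ ⊥ := by
    rintro rfl
    simp at hW
  obtain ⟨w₀, hw₀W, hw₀⟩ := (Submodule.ne_bot_iff W).mp hWne
  have hw₀1 : w₀.1 ≠ 0 := fun h0 => hw₀ (Prod.ext h0 (funext fun j => j.elim0))
  -- every `σ ∈ Σ` is a root of multiplicity `> T`
  have hmult : ∀ σ ∈ S, T < p.rootMultiplicity (Multiplicative.toAdd σ.1) := by
    intro σ hσ
    set a : ℂ := Multiplicative.toAdd σ.1 with ha
    have hv := hvan σ (hS_sub hσ)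
    set ℓ : ↥W →L[ℂ] ℂ := (ContinuousLinearMap.fst ℂ ℂ (Fin 0 → ℂ)).comp W.subtypeL with hℓ
    have hℓw : ∀ w : ↥W, ℓ w = (w : ℂ × (Fin 0 → ℂ)).1 := fun w => by simp [hℓ]
    have hfun : (fun w : ↥W => evalAt P (σ * GaGm.exp (w : ℂ × (Fin 0 → ℂ)))) =
        (fun t : ℂ => p.eval (a + t)) ∘ ℓ := by
      funext w
      simp only [Function.comp_apply, evalAt]
      have hc : coord (σ * GaGm.exp (w : ℂ × (Fin 0 → ℂ))) =
          Fin.cons (a + (w : ℂ × (Fin 0 → ℂ)).1) Fin.elim0 := by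
        funext i
        refine Fin.cases ?_ (fun j => j.elim0) i
        simp [coord, GaGm.exp, ha, toAdd_mul]
      rw [hc, hevalP, hℓw]
    have hcd : ContDiff ℂ ⊤ (fun t : ℂ => p.eval (a + t)) := by
      have h1 : ContDiff ℂ ⊤ (fun x : ℂ => Polynomial.aeval x p) := p.contDiff_aeval ⊤
      have h2 : (fun t : ℂ => p.eval (a + t)) =
          (fun x : ℂ => Polynomial.aeval x p) ∘ fun t : ℂ => a + t := by
        funext t
        simp [Polynomial.coe_aeval_eq_eval]
      rw [h2]
      exact h1.comp (contDiff_const.add contDiff_id)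
    have hder : ∀ k ≤ T, (Polynomial.derivative^[k] p).IsRoot a := by
      intro k hk
      have hk' : k < (0 + 1) * T + 1 := by omega
      have h0 := hv k hk'
      rw [hfun, ℓ.iteratedFDeriv_comp_right hcd 0 (by exact_mod_cast le_top), map_zero] at h0
      have h1 := DFunLike.congr_fun h0 (fun _ => (⟨w₀, hw₀W⟩ : ↥W))
      simp only [ContinuousMultilinearMap.compContinuousLinearMap_apply, zero_apply, hℓw] at h1
      rw [iteratedFDeriv_apply_eq_iteratedDeriv_mul_prod, Finset.prod_const, Finset.card_univ,
        Fintype.card_fin, smul_eq_zero] at h1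
      have h2 : iteratedDeriv k (fun t : ℂ => p.eval (a + t)) 0 = 0 :=
        h1.resolve_left (pow_ne_zero k hw₀1)
      rw [iteratedDeriv_comp_const_add k (fun x : ℂ => p.eval x) a] at h2
      simp only [add_zero, iteratedDeriv_polynomial_eval] at h2
      exact h2
    exact (Polynomial.lt_rootMultiplicity_iff_isRoot_iterate_derivative hp0).mpr hder
  -- root counting: `(T + 1) · card Σ ≤ deg p ≤ D₀`
  have hcount : (T + 1) * hS.toFinset.card ≤ D₀ := by
    have hinj : Function.Injective (fun σ : GaGm 0 => Multiplicative.toAdd σ.1) := by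
      intro σ τ h
      exact Prod.ext (Multiplicative.toAdd.injective h) (funext fun j => j.elim0)
    calc (T + 1) * hS.toFinset.card
        = ∑ _σ ∈ hS.toFinset, (T + 1) := by rw [Finset.sum_const, smul_eq_mul, mul_comm]
      _ ≤ ∑ σ ∈ hS.toFinset, p.roots.count (Multiplicative.toAdd σ.1) := by
          refine Finset.sum_le_sum fun σ hσ => ?_
          rw [Polynomial.count_roots]
          exact hmult σ (hS.mem_toFinset.mp hσ)
      _ = ∑ x ∈ hS.toFinset.image (fun σ : GaGm 0 => Multiplicative.toAdd σ.1),
            p.roots.count x := by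
          rw [Finset.sum_image fun σ _ τ _ h => hinj h]
      _ ≤ ∑ x ∈ p.roots.toFinset, p.roots.count x := by
          refine Finset.sum_le_sum_of_ne_zero fun x _ hx => ?_
          rw [Multiset.mem_toFinset]
          exact Multiset.count_ne_zero.mp hx
      _ = Multiset.card p.roots := Multiset.toFinset_sum_count_eq _
      _ ≤ p.natDegree := p.card_roots'
      _ ≤ D₀ := hpdeg
  -- the obstruction subgroup is `{e}`
  refine ⟨ConnAlgSubgroup.bot 0, ⟨1, fun h hh => ?_⟩, ?_⟩
  · rw [(ConnAlgSubgroup.mem_toSubgroup_bot_iff h).mp hh, mul_one]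
    exact (vanishesToOrder_one_iff P W 1).mp ((hvan 1 (hS_sub h1)).mono (by omega))
  · have hfW : Module.finrank ℂ W = 1 := by
      have h1 : Module.finrank ℂ (ℂ × (Fin 0 → ℂ)) = 1 := by simp
      have h2 := W.finrank_le
      omega
    have htan : W ⊓ (ConnAlgSubgroup.bot 0).tangent = ⊥ := by
      rw [ConnAlgSubgroup.tangent_bot, inf_bot_eq]
    have hnc : Set.ncard ((QuotientGroup.mk : GaGm 0 → GaGm 0 ⧸
        (ConnAlgSubgroup.bot 0).toSubgroup) '' S) ≤ hS.toFinset.card := by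
      rw [← Set.ncard_eq_toFinset_card S hS]
      exact Set.ncard_image_le hS
    rw [htan, finrank_bot, hfW, ConnAlgSubgroup.addDim_bot, ConnAlgSubgroup.torusDim_bot]
    simp only [Nat.sub_zero, Nat.choose_one_right, pow_zero, mul_one, one_mul]
    calc (T + 1) * Set.ncard _ ≤ (T + 1) * hS.toFinset.card := Nat.mul_le_mul_left _ hnc
      _ ≤ D₀ := hcount

end Literature.NumberTheory.Transcendental

end
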